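import Mathlib
import Literature.Probability.Distributions.GaussianCoordinateMoments
import HarnessLib

/-!
# The covariance of lag products under the Gaussian (Wick) model: `cov[XᵢXⱼ, XₖXₗ] = CᵢₖCⱼₗ + CᵢₗCⱼₖ`, and the EXACT finite-`N` covariance of the empirical autocovariances

HONEST FRAMING: exact (Metropolis-corrected) sampling algorithms for lattice gauge theory;
figures of merit are autocorrelation/cost numbers at stated couplings and volumes; no
continuum-physics claim.

Venture `LatticeQCDFlow` (cell pub-lqcd), sub-topic `Scoring`; FANOUT row 16 (`su2-base`, the
4D SU(2) baselines), GEN-6.  NEW WORK of the cell over Mathlib and the Literature's Isserlis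
theorem (`Literature.Probability.Distributions.integral_quartForm_stdGaussian`, Janson 1997
Thm 1.28); nothing here is cited as a fact.  Printed counterparts, NAMED ONLY: Bartlett 1946,
Priestley 1981 §5.3 (eqs. (5.3.21)–(5.3.26)), Broersen 2006 §3.5 eqs. (3.34)–(3.35) (held),
Madras–Sokal 1988 App. (the error of `τ̂_int`), Wolff 2004 §3.

First file of the ERROR-OF-THE-ERROR packet.  Row 16's acceptance (d) reads 'errors on τ_int
≤ 15 %', the error being the PRINTED bar `δτ = τ √((4W + 2)/N)` of the windowed estimator
`τ̂_W = ½ + Σ_{t=1}^{W} Γ̂(t)/Γ̂(0)` (scorer B; `Scoring/MadrasSokalWindow.msDTau`; Wolff's variant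
`CalibrationTruths.wolffDTau`).  The tree DEFINES that bar; this packet DERIVES it: it is the
large-window asymptote of the `N → ∞` variance of `τ̂_W` when the data are Gaussian.  The one
modelling input is typed here as a hypothesis on the process — the WICK (Isserlis) structure of
its fourth moments — and discharged for every family of linear statistics of a standard Gaussian
vector.

## Contents

* `IsWickFamily X C μ` — the second moments of the real process `X : ℕ → Ω → ℝ` are `C i j` and
  its fourth moments pair off: `E[XᵢXⱼXₖXₗ] = CᵢⱼCₖₗ + CᵢₖCⱼₗ + CᵢₗCⱼₖ` (lag products in `L²`);
  `IsWickFamily.symm` (`C` is symmetric).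
* **`IsWickFamily.covariance_mul_mul`** — `cov[XᵢXⱼ, XₖXₗ] = CᵢₖCⱼₗ + CᵢₗCⱼₖ`.
* `acovHat X N t = (1/N) Σ_{i<N} Xᵢ X_{i+t}` — the empirical autocovariance at lag `t` from `N`
  lag products, known mean (the Γ-method's `Γ̂(t)` up to the mean subtraction and the `1/(N−t)`
  versus `1/N` convention, both immaterial at leading order and NOT modelled here);
  `integral_acovHat` — its mean is `(1/N) Σ_{i<N} C i (i+t)` (`= c t` under stationarity:
  `integral_acovHat_of_stationary`, UNBIASED);
* **`IsWickFamily.covariance_acovHat`** — the exact finite-`N` covariance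
  `cov[Γ̂_N(s), Γ̂_N(t)] = N⁻² Σ_{i,j<N} (C i j · C (i+s) (j+t) + C i (j+t) · C (i+s) j)`;
  **`covariance_acovHat_of_stationary`** — for `C i j = c (j − i)` (`c : ℤ → ℝ`):
  `cov[Γ̂_N(s), Γ̂_N(t)] = N⁻² Σ_{i,j<N} g_{s,t}(j − i)` with the BARTLETT SUMMAND
  `g_{s,t}(m) = c(m) c(m + t − s) + c(m + t) c(m − s)` (`bartlettSummand`) — Bartlett's formula
  before any limit is taken.
* The Gaussian instance: `gaussLin b a i = v ↦ Σ_p a i p ⟪b p, v⟫` (linear statistics of a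
  standard Gaussian vector in an orthonormal basis `b`), `gramCov a i k = Σ_p a i p · a k p`;
  **`isWickFamily_gaussLin`** — they form a Wick family under `stdGaussian E` (Isserlis).  Every
  centred Gaussian vector `(X₀,…,X_n)` is of this form (rows of a square root of its covariance)
  — said, not typed.

NOT CLAIMED: anything non-Gaussian (for a general stationary process the fourth cumulant enters
Bartlett's formula); mean subtraction; the `1/(N − t)` normalisation; any limit (next files:
`FejerPairSums`, `BartlettKernel`, `MadrasSokalErrorFormula`).
-/

noncomputable section

open MeasureTheory ProbabilityTheory Finset
open scoped BigOperators InnerProductSpace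

namespace Summit.Ventures.LatticeQCDFlow.Scoring

variable {Ω : Type*} {mΩ : MeasurableSpace Ω} {μ : Measure Ω}

/-! ## Wick families -/

/-- A real process `X : ℕ → Ω → ℝ` is a WICK FAMILY with covariance `C` under `μ` when its lag
products are square integrable, `E[XᵢXⱼ] = C i j`, and its fourth moments pair off as for a centred
Gaussian vector (Isserlis): `E[XᵢXⱼXₖXₗ] = CᵢⱼCₖₗ + CᵢₖCⱼₗ + CᵢₗCⱼₖ` — the moment structure of
a Gaussian process up to order four, as a hypothesis. [folklore] -/
@[folklore]
structure IsWickFamily (X : ℕ → Ω → ℝ) (C : ℕ → ℕ → ℝ) (μ : Measure Ω) : Prop where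
  /-- lag products are in `L²` (fourth moments exist) -/
  memLp : ∀ i j, MemLp (fun ω => X i ω * X j ω) 2 μ
  /-- second moments -/
  two : ∀ i j, ∫ ω, X i ω * X j ω ∂μ = C i j
  /-- fourth moments pair off (Wick / Isserlis) -/
  four : ∀ i j k l, ∫ ω, X i ω * X j ω * X k ω * X l ω ∂μ
    = C i j * C k l + C i k * C j l + C i l * C j k

namespace IsWickFamily

variable {X : ℕ → Ω → ℝ} {C : ℕ → ℕ → ℝ}

/-- The covariance of a Wick family is symmetric. -/
theorem symm (h : IsWickFamily X C μ) (i j : ℕ) : C i j = C j i := by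
  rw [← h.two i j, ← h.two j i]
  simp_rw [mul_comm]

/-- Lag products are integrable (finite measure). -/
theorem integrable_mul [IsFiniteMeasure μ] (h : IsWickFamily X C μ) (i j : ℕ) :
    Integrable (fun ω => X i ω * X j ω) μ :=
  (h.memLp i j).integrable one_le_two

/-- Products of four are integrable (finite measure). -/
theorem integrable_mul_mul [IsFiniteMeasure μ] (h : IsWickFamily X C μ) (i j k l : ℕ) :
    Integrable (fun ω => X i ω * X j ω * X k ω * X l ω) μ := by
  have h4 := (h.memLp i j).integrable_mul (h.memLp k l)
  refine h4.congr (Filter.Eventually.of_forall fun ω => ?_)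
  simp only [Pi.mul_apply]
  ring

/-- **The covariance of two lag products under the Wick model**:
`cov[XᵢXⱼ, XₖXₗ] = CᵢₖCⱼₗ + CᵢₗCⱼₖ`. -/
theorem covariance_mul_mul [IsProbabilityMeasure μ] (h : IsWickFamily X C μ) (i j k l : ℕ) :
    cov[fun ω => X i ω * X j ω, fun ω => X k ω * X l ω; μ] = C i k * C j l + C i l * C j k := by
  rw [covariance_eq_sub (h.memLp i j) (h.memLp k l)]
  have h4 : ∫ ω, ((fun ω => X i ω * X j ω) * fun ω => X k ω * X l ω) ω ∂μ
      = C i j * C k l + C i k * C j l + C i l * C j k := by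
    rw [← h.four i j k l]
    refine integral_congr_ae (Filter.Eventually.of_forall fun ω => ?_)
    simp only [Pi.mul_apply]
    ring
  have h2 : ∫ ω, (fun ω => X i ω * X j ω) ω ∂μ = C i j := h.two i j
  have h2' : ∫ ω, (fun ω => X k ω * X l ω) ω ∂μ = C k l := h.two k l
  rw [h4, h2, h2']
  ring

/-- In particular the variance of a lag product: `Var[XᵢXⱼ] = CᵢᵢCⱼⱼ + Cᵢⱼ²`. -/
theorem variance_mul [IsProbabilityMeasure μ] (h : IsWickFamily X C μ) (i j : ℕ) :
    Var[fun ω => X i ω * X j ω; μ] = C i i * C j j + C i j ^ 2 := by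
  rw [← covariance_self ((h.memLp i j).aestronglyMeasurable.aemeasurable), h.covariance_mul_mul,
    h.symm j i]
  ring

end IsWickFamily

/-! ## The empirical autocovariance and its exact covariance -/

/-- The empirical autocovariance at lag `t` from `N` lag products, known mean, normalised by `N`:
`Γ̂_N(t) = (1/N) Σ_{i<N} Xᵢ X_{i+t}`. [ours] -/
def acovHat (X : ℕ → Ω → ℝ) (N t : ℕ) : Ω → ℝ :=
  fun ω => (∑ i ∈ range N, X i ω * X (i + t) ω) / N

/-- Unfolding lemma for `acovHat`. -/
theorem acovHat_apply (X : ℕ → Ω → ℝ) (N t : ℕ) (ω : Ω) :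
    acovHat X N t ω = (∑ i ∈ range N, X i ω * X (i + t) ω) / N := rfl

namespace IsWickFamily

variable {X : ℕ → Ω → ℝ} {C : ℕ → ℕ → ℝ}

/-- `Γ̂_N(t)` is square integrable. -/
theorem memLp_acovHat (h : IsWickFamily X C μ) (N t : ℕ) : MemLp (acovHat X N t) 2 μ := by
  have hs : MemLp (fun ω => ∑ i ∈ range N, X i ω * X (i + t) ω) 2 μ :=
    memLp_finsetSum _ fun i _ => h.memLp i (i + t)
  have heq : acovHat X N t = fun ω => (∑ i ∈ range N, X i ω * X (i + t) ω) * (1 / (N : ℝ)) := by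
    funext ω
    rw [acovHat_apply, div_eq_mul_one_div]
  rw [heq]
  exact hs.mul_const _

/-- **The mean of `Γ̂_N(t)`**: `E[Γ̂_N(t)] = (1/N) Σ_{i<N} C i (i+t)`. -/
theorem integral_acovHat [IsFiniteMeasure μ] (h : IsWickFamily X C μ) (N t : ℕ) :
    ∫ ω, acovHat X N t ω ∂μ = (∑ i ∈ range N, C i (i + t)) / N := by
  simp only [acovHat_apply]
  rw [integral_div, integral_finsetSum _ fun i _ => h.integrable_mul i (i + t)]
  simp_rw [h.two]

/-- **The exact finite-`N` covariance of the empirical autocovariances under the Wick model**: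
`cov[Γ̂_N(s), Γ̂_N(t)] = N⁻² Σ_{i<N} Σ_{j<N} (C i j · C (i+s) (j+t) + C i (j+t) · C (i+s) j)`. -/
theorem covariance_acovHat [IsProbabilityMeasure μ] (h : IsWickFamily X C μ) (N s t : ℕ) :
    cov[acovHat X N s, acovHat X N t; μ]
      = (∑ i ∈ range N, ∑ j ∈ range N,
          (C i j * C (i + s) (j + t) + C i (j + t) * C (i + s) j)) / (N : ℝ) ^ 2 := by
  unfold acovHat
  rw [covariance_fun_div_left, covariance_fun_div_right,
    covariance_fun_sum_fun_sum' (fun i _ => h.memLp i (i + s)) (fun j _ => h.memLp j (j + t))]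
  simp_rw [h.covariance_mul_mul]
  rw [div_div, ← sq]

/-- The variance of `Γ̂_N(t)` (the case `s = t`). -/
theorem variance_acovHat [IsProbabilityMeasure μ] (h : IsWickFamily X C μ) (N t : ℕ) :
    Var[acovHat X N t; μ]
      = (∑ i ∈ range N, ∑ j ∈ range N,
          (C i j * C (i + t) (j + t) + C i (j + t) * C (i + t) j)) / (N : ℝ) ^ 2 := by
  rw [← covariance_self (h.memLp_acovHat N t).aestronglyMeasurable.aemeasurable,
    h.covariance_acovHat]

end IsWickFamily

/-! ## Stationary covariances: Bartlett's summand -/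

/-- BARTLETT'S SUMMAND at lags `(s, t)`: `g_{s,t}(m) = c(m) c(m + t − s) + c(m + t) c(m − s)` for a
stationary covariance function `c : ℤ → ℝ`. [ours] -/
def bartlettSummand (c : ℤ → ℝ) (s t : ℕ) (m : ℤ) : ℝ :=
  c m * c (m + t - s) + c (m + t) * c (m - s)

/-- Unfolding lemma for `bartlettSummand`. -/
theorem bartlettSummand_apply (c : ℤ → ℝ) (s t : ℕ) (m : ℤ) :
    bartlettSummand c s t m = c m * c (m + t - s) + c (m + t) * c (m - s) := rfl

namespace IsWickFamily

variable {X : ℕ → Ω → ℝ} {C : ℕ → ℕ → ℝ} {c : ℤ → ℝ}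

/-- Under stationarity `C i j = c (j − i)` the covariance function is even on the lags that occur:
`c (−m) = c m` for every `m : ℤ` (both signs are differences of naturals). -/
theorem even_of_stationary (h : IsWickFamily X C μ) (hC : ∀ i j, C i j = c ((j : ℤ) - i))
    (m : ℤ) : c (-m) = c m := by
  obtain ⟨n, rfl | rfl⟩ := Int.eq_nat_or_neg m
  · have := h.symm 0 n
    rw [hC, hC] at this
    simpa using this.symm
  · have := h.symm 0 n
    rw [hC, hC] at this
    simpa using this

/-- **Unbiasedness under stationarity**: `E[Γ̂_N(t)] = c t` for `N ≥ 1`. -/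
theorem integral_acovHat_of_stationary [IsFiniteMeasure μ] (h : IsWickFamily X C μ)
    (hC : ∀ i j, C i j = c ((j : ℤ) - i)) {N : ℕ} (hN : N ≠ 0) (t : ℕ) :
    ∫ ω, acovHat X N t ω ∂μ = c t := by
  rw [h.integral_acovHat]
  have : ∀ i ∈ range N, C i (i + t) = c t := by
    intro i _
    rw [hC]
    congr 1
    push_cast
    ring
  rw [sum_congr rfl this, sum_const, card_range, nsmul_eq_mul]
  field_simp

/-- **Bartlett's formula at finite `N` (exact, Wick model)**: for a stationary covariance
`C i j = c (j − i)`,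
`cov[Γ̂_N(s), Γ̂_N(t)] = N⁻² Σ_{i<N} Σ_{j<N} g_{s,t}(j − i)` with `g_{s,t} = bartlettSummand c s t`. -/
theorem covariance_acovHat_of_stationary [IsProbabilityMeasure μ] (h : IsWickFamily X C μ)
    (hC : ∀ i j, C i j = c ((j : ℤ) - i)) (N s t : ℕ) :
    cov[acovHat X N s, acovHat X N t; μ]
      = (∑ i ∈ range N, ∑ j ∈ range N, bartlettSummand c s t ((j : ℤ) - i)) / (N : ℝ) ^ 2 := by
  rw [h.covariance_acovHat]
  congr 1
  refine sum_congr rfl fun i _ => sum_congr rfl fun j _ => ?_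
  simp only [bartlettSummand, hC]
  have e1 : (((j + t : ℕ) : ℤ) - ((i + s : ℕ) : ℤ)) = (j : ℤ) - i + t - s := by push_cast; ring
  have e2 : (((j + t : ℕ) : ℤ) - (i : ℤ)) = (j : ℤ) - i + t := by push_cast; ring
  have e3 : ((j : ℤ) - ((i + s : ℕ) : ℤ)) = (j : ℤ) - i - s := by push_cast; ring
  rw [e1, e2, e3]

end IsWickFamily

/-! ## The Gaussian instance: linear statistics of a standard Gaussian vector -/

section Gaussian

open Literature.Probability.Distributions

variable {E : Type*} [NormedAddCommGroup E] [InnerProductSpace ℝ E] [FiniteDimensional ℝ E]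
  [MeasurableSpace E] [BorelSpace E]
variable {ι : Type*} [Fintype ι] [DecidableEq ι]

/-- Linear statistics of a standard Gaussian vector: `Xᵢ(v) = Σ_p a i p · ⟪b p, v⟫` for an
orthonormal basis `b` and coefficient rows `a i`. [ours] -/
def gaussLin (b : OrthonormalBasis ι ℝ E) (a : ℕ → ι → ℝ) (i : ℕ) : E → ℝ :=
  fun v => ∑ p, a i p * ⟪b p, v⟫_ℝ

/-- The Gram covariance of the coefficient rows: `C i k = Σ_p a i p · a k p`. [ours] -/
def gramCov (a : ℕ → ι → ℝ) (i k : ℕ) : ℝ := ∑ p, a i p * a k p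

omit [FiniteDimensional ℝ E] [MeasurableSpace E] [BorelSpace E] [DecidableEq ι] in
/-- `gaussLin` is continuous. -/
theorem continuous_gaussLin (b : OrthonormalBasis ι ℝ E) (a : ℕ → ι → ℝ) (i : ℕ) :
    Continuous (gaussLin b a i) := by
  unfold gaussLin
  fun_prop

omit [FiniteDimensional ℝ E] [MeasurableSpace E] [BorelSpace E] [DecidableEq ι] in
/-- The product of two linear statistics as a quadratic form in the coordinates. -/
theorem gaussLin_mul_gaussLin (b : OrthonormalBasis ι ℝ E) (a : ℕ → ι → ℝ) (i k : ℕ) (v : E) :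
    gaussLin b a i v * gaussLin b a k v
      = ∑ p, ∑ q, ⟪b p, v⟫_ℝ * ⟪b q, v⟫_ℝ * (a i p * a k q) := by
  simp only [gaussLin, sum_mul_sum]
  refine sum_congr rfl fun p _ => sum_congr rfl fun q _ => ?_
  ring

omit [FiniteDimensional ℝ E] [MeasurableSpace E] [BorelSpace E] [DecidableEq ι] in
/-- The product of four linear statistics as a quartic form in the coordinates. -/
theorem gaussLin_mul_four (b : OrthonormalBasis ι ℝ E) (a : ℕ → ι → ℝ) (i j k l : ℕ) (v : E) :
    gaussLin b a i v * gaussLin b a j v * gaussLin b a k v * gaussLin b a l v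
      = ∑ p, ∑ q, ∑ r, ∑ w, ⟪b p, v⟫_ℝ * ⟪b q, v⟫_ℝ * ⟪b r, v⟫_ℝ * ⟪b w, v⟫_ℝ
          * (a i p * a j q * a k r * a l w) := by
  rw [show gaussLin b a i v * gaussLin b a j v * gaussLin b a k v * gaussLin b a l v
      = (gaussLin b a i v * gaussLin b a j v) * (gaussLin b a k v * gaussLin b a l v) by ring,
    gaussLin_mul_gaussLin, gaussLin_mul_gaussLin, Finset.sum_mul]
  refine sum_congr rfl fun p _ => ?_
  rw [Finset.sum_mul]
  refine sum_congr rfl fun q _ => ?_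
  rw [Finset.mul_sum]
  refine sum_congr rfl fun r _ => ?_
  rw [Finset.mul_sum]
  refine sum_congr rfl fun w _ => ?_
  ring

/-- Second moments of the linear statistics: `E[XᵢXₖ] = Σ_p a i p · a k p`. -/
theorem integral_gaussLin_mul (b : OrthonormalBasis ι ℝ E) (a : ℕ → ι → ℝ) (i k : ℕ) :
    ∫ v, gaussLin b a i v * gaussLin b a k v ∂stdGaussian E = gramCov a i k := by
  simp_rw [gaussLin_mul_gaussLin]
  rw [integral_quadForm_stdGaussian]
  rfl

/-- Fourth moments of the linear statistics pair off (Isserlis). -/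
theorem integral_gaussLin_four (b : OrthonormalBasis ι ℝ E) (a : ℕ → ι → ℝ) (i j k l : ℕ) :
    ∫ v, gaussLin b a i v * gaussLin b a j v * gaussLin b a k v * gaussLin b a l v ∂stdGaussian E
      = gramCov a i j * gramCov a k l + gramCov a i k * gramCov a j l
        + gramCov a i l * gramCov a j k := by
  simp_rw [gaussLin_mul_four]
  rw [integral_quartForm_stdGaussian]
  simp only [gramCov, sum_mul_sum]
  congr 1
  congr 1
  · exact sum_congr rfl fun p _ => sum_congr rfl fun q _ => by ring
  · exact sum_congr rfl fun p _ => sum_congr rfl fun q _ => by ring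
  · exact sum_congr rfl fun p _ => sum_congr rfl fun q _ => by ring

/-- Products of four linear statistics are integrable under the standard Gaussian. -/
theorem integrable_gaussLin_four (b : OrthonormalBasis ι ℝ E) (a : ℕ → ι → ℝ) (i j k l : ℕ) :
    Integrable (fun v => gaussLin b a i v * gaussLin b a j v * gaussLin b a k v * gaussLin b a l v)
      (stdGaussian E) := by
  simp_rw [gaussLin_mul_four]
  refine integrable_finsetSum _ fun p _ => integrable_finsetSum _ fun q _ =>
    integrable_finsetSum _ fun r _ => integrable_finsetSum _ fun w _ => ?_
  exact (integrable_coord_four_stdGaussian b p q r w).mul_const _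

/-- Lag products of the linear statistics are square integrable. -/
theorem memLp_gaussLin_mul (b : OrthonormalBasis ι ℝ E) (a : ℕ → ι → ℝ) (i k : ℕ) :
    MemLp (fun v => gaussLin b a i v * gaussLin b a k v) 2 (stdGaussian E) := by
  refine (memLp_two_iff_integrable_sq ?_).2 ?_
  · exact ((continuous_gaussLin b a i).mul (continuous_gaussLin b a k)).aestronglyMeasurable
  refine (integrable_gaussLin_four b a i k i k).congr (Filter.Eventually.of_forall fun v => ?_)
  simp only
  ring

/-- **Linear statistics of a standard Gaussian vector form a Wick family** with the Gram
covariance of their coefficient rows (Isserlis' theorem, via the Literature's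
`integral_quartForm_stdGaussian`). -/
theorem isWickFamily_gaussLin (b : OrthonormalBasis ι ℝ E) (a : ℕ → ι → ℝ) :
    IsWickFamily (gaussLin b a) (gramCov a) (stdGaussian E) where
  memLp i k := memLp_gaussLin_mul b a i k
  two i k := integral_gaussLin_mul b a i k
  four i j k l := integral_gaussLin_four b a i j k l

/-- Hence, for Gaussian linear statistics, `cov[XᵢXⱼ, XₖXₗ] = CᵢₖCⱼₗ + CᵢₗCⱼₖ` with the Gram
covariance `C`. -/
theorem covariance_gaussLin_mul_mul (b : OrthonormalBasis ι ℝ E) (a : ℕ → ι → ℝ) (i j k l : ℕ) :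
    cov[fun v => gaussLin b a i v * gaussLin b a j v, fun v => gaussLin b a k v * gaussLin b a l v;
      stdGaussian E]
      = gramCov a i k * gramCov a j l + gramCov a i l * gramCov a j k :=
  (isWickFamily_gaussLin b a).covariance_mul_mul i j k l

end Gaussian

end Summit.Ventures.LatticeQCDFlow.Scoring
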